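import Summits.KontsevichZagierPeriods.KontsevichZagierPeriods.Theorems.SoloInformedNLCellData
import HarnessLib
import HarnessLib.Audit

/-!
# SoloInformed — KEY LEMMA (K): integer multiplicities on the open cells of an adapted decomposition (Newton–Leibniz elimination, file 4c-i)

Solo programme `solo-KontsevichZagierPeriods-informed`, session s245 (K-NF, `paper/nl-elimination.md`
§2 KEY LEMMA (K) and §7.2, FILE 4c).

Let `𝒯` be a `ℚ`-cylindrical decomposition of `ℝⁿ` adapted to the domains `E_i` of finitely many
representations `ρ_i = [E_i, 1]` with integrand `1`, and let `ε_i ∈ ℤ`.  Modulo the equidimensional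
relations `relations₁₂` every `[E_i, 1]` is the sum of the unit representations `[D, 1]` of the
OPEN cells `D ⊆ E_i` (`SoloInformedCADCells`), and for a fixed open cell `D` all these `[D, 1]`
are the same element of `FormalRep`.  Hence

  `∑ i, ε_i • [E_i, 1] ≡ ∑_{D open} m_D • [D, 1]`,  `m_D = ∑_{i : D ⊆ E_i} ε_i`,

and if every multiplicity `m_D` vanishes then `∑ i, ε_i • [E_i, 1] ∈ relations₁₂`
(`soloInformed_sum_smul_of_mem_of_multiplicity_eq_zero`).  This is the bookkeeping half of
THEOREM NF; the multiplicities of the two sides of a Newton–Leibniz move are computed in FILE 4c-ii.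

References: M. Kontsevich, D. Zagier, *Periods* (2001), §1.2; Basu–Pollack–Roy (2006), Def. 5.1;
this work (THEOREM NF, KEY LEMMA (K), `paper/nl-elimination.md` §2).
-/

noncomputable section

open scoped BigOperators Topology

namespace Summit.KontsevichZagierPeriods.KontsevichZagierPeriods.Theorems

open Set MeasureTheory Filter
open Literature.ModelTheory.ExponentialFields
open Literature.NumberTheory.Transcendental Literature.NumberTheory.Transcendental.KZ

variable {n : ℕ}

/-! ### Cells of an adapted partition: containment is decided pointwise -/

/-- A cell of a partition contained in a union `E` of cells is one of them. -/
theorem soloInformed_cell_mem_of_subset {α : Type*} {𝒯 𝒞 : Finset (Set α)}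
    (hpart : Setoid.IsPartition (𝒯 : Set (Set α))) (h𝒞 : 𝒞 ⊆ 𝒯) {E : Set α}
    (hU : ⋃₀ (𝒞 : Set (Set α)) = E) {D : Set α} (hD : D ∈ 𝒯) (hDE : D ⊆ E) : D ∈ 𝒞 := by
  have hne : D.Nonempty := by
    rw [nonempty_iff_ne_empty]
    rintro rfl
    exact hpart.1 hD
  obtain ⟨z, hz⟩ := hne
  have hz' : z ∈ ⋃₀ (𝒞 : Set (Set α)) := hU ▸ hDE hz
  obtain ⟨D', hD'𝒞, hzD'⟩ := mem_sUnion.1 hz'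
  by_cases h : D = D'
  · exact h ▸ hD'𝒞
  · exact absurd (hpart.pairwiseDisjoint hD (h𝒞 hD'𝒞) h) (not_disjoint_iff.2 ⟨z, hz, hzD'⟩)

/-- For a cell `D` of a partition adapted to `E`: `D ⊆ E ↔ D` is one of the cells of `E`. -/
theorem soloInformed_cell_subset_iff_mem {α : Type*} {𝒯 𝒞 : Finset (Set α)}
    (hpart : Setoid.IsPartition (𝒯 : Set (Set α))) (h𝒞 : 𝒞 ⊆ 𝒯) {E : Set α}
    (hU : ⋃₀ (𝒞 : Set (Set α)) = E) {D : Set α} (hD : D ∈ 𝒯) : D ⊆ E ↔ D ∈ 𝒞 :=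
  ⟨soloInformed_cell_mem_of_subset hpart h𝒞 hU hD, fun h => hU ▸ subset_sUnion_of_mem h⟩

/-- For a cell `D ∋ z` of a partition adapted to `E`: `D ⊆ E ↔ z ∈ E`. -/
theorem soloInformed_cell_subset_iff_mem_pt {α : Type*} {𝒯 𝒞 : Finset (Set α)}
    (hpart : Setoid.IsPartition (𝒯 : Set (Set α))) (h𝒞 : 𝒞 ⊆ 𝒯) {E : Set α}
    (hU : ⋃₀ (𝒞 : Set (Set α)) = E) {D : Set α} (hD : D ∈ 𝒯) {z : α} (hz : z ∈ D) :
    D ⊆ E ↔ z ∈ E := by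
  refine ⟨fun h => h hz, fun h => ?_⟩
  rcases soloInformed_cell_subset_or_disjoint hpart h𝒞 hU hD with h' | h'
  · exact h'
  · exact absurd h (disjoint_left.1 h' hz)

/-! ### Unit representations on a common cell coincide -/

/-- Two restrictions to the same cell of representations with integrand `1` are equal. -/
theorem soloInformed_cadRep_eq_of_integrand_one {ρ ρ' : IntegralRep n} {D : Set (Fin n → ℝ)}
    (hD : IsSemialgebraic ℚ D) (hDρ : D ⊆ ρ.domain) (hDρ' : D ⊆ ρ'.domain)
    (hone : ρ.integrand = fun _ => 1) (hone' : ρ'.integrand = fun _ => 1) :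
    soloInformedCadRep ρ D = soloInformedCadRep ρ' D :=
  IntegralRep.ext' (by rw [soloInformed_cadRep_domain ρ hD hDρ, soloInformed_cadRep_domain ρ' hD hDρ'])
    (by rw [soloInformed_cadRep_integrand, soloInformed_cadRep_integrand, hone, hone'])

/-! ### KEY LEMMA (K) -/

open Classical in
/-- **KEY LEMMA (K), bookkeeping form.**  If a `ℚ`-cylindrical decomposition `𝒯` is adapted to the
domains of finitely many representations `ρ_i` with integrand `1`, and for every OPEN cell `D` the
multiplicity `∑_{i : D ⊆ dom ρ_i} ε_i` vanishes, then `∑ i, ε_i • [ρ_i] ∈ relations₁₂`. -/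
theorem soloInformed_sum_smul_of_mem_of_multiplicity_eq_zero
    {𝒯 : Finset (Set (Fin n → ℝ))} (h𝒯 : IsCylindricalDecomposition ℚ n 𝒯)
    {ι : Type*} (I : Finset ι) (ρ : ι → IntegralRep n) (ε : ι → ℤ)
    (hone : ∀ i ∈ I, (ρ i).integrand = fun _ => 1)
    (𝒞 : ι → Finset (Set (Fin n → ℝ))) (h𝒞 : ∀ i ∈ I, 𝒞 i ⊆ 𝒯)
    (hU : ∀ i ∈ I, ⋃₀ (𝒞 i : Set (Set (Fin n → ℝ))) = (ρ i).domain)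
    (hmult : ∀ D ∈ 𝒯, IsOpen D → ∑ i ∈ I.filter (fun i => D ⊆ (ρ i).domain), ε i = 0) :
    ∑ i ∈ I, ε i • of (ρ i) ∈ soloInformedEquidimRelations := by
  -- split every `ρ i` along the open cells of `𝒯`
  set T : FormalRep := ∑ i ∈ I, ε i • ∑ D ∈ (𝒞 i).filter IsOpen, of (soloInformedCadRep (ρ i) D)
    with hT
  have h1 : ∑ i ∈ I, ε i • of (ρ i) - T ∈ soloInformedEquidimRelations := by
    rw [hT, ← Finset.sum_sub_distrib]
    refine AddSubgroup.sum_mem _ fun i hi => ?_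
    rw [← smul_sub]
    exact AddSubgroup.zsmul_mem _
      (soloInformed_of_sub_sum_openCells_mem h𝒯 (ρ i) (h𝒞 i hi) (hU i hi)) _
  -- the split sum vanishes identically
  have h2 : T = 0 := by
    have hinner : ∀ i ∈ I, ∑ D ∈ (𝒞 i).filter IsOpen, of (soloInformedCadRep (ρ i) D) =
        ∑ D ∈ 𝒯.filter IsOpen,
          if D ∈ 𝒞 i then of (soloInformedCadRep (ρ i) D) else 0 := by
      intro i hi
      rw [← Finset.sum_filter]
      congr 1
      ext D
      simp only [Finset.mem_filter]
      constructor
      · rintro ⟨hD, hDo⟩; exact ⟨⟨h𝒞 i hi hD, hDo⟩, hD⟩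
      · rintro ⟨⟨-, hDo⟩, hD⟩; exact ⟨hD, hDo⟩
    rw [hT, Finset.sum_congr rfl fun i hi => by rw [hinner i hi]]
    simp_rw [Finset.smul_sum]
    rw [Finset.sum_comm]
    refine Finset.sum_eq_zero fun D hD => ?_
    obtain ⟨hD𝒯, hDo⟩ := Finset.mem_filter.1 hD
    by_cases hex : ∃ i₀ ∈ I, D ∈ 𝒞 i₀
    · obtain ⟨i₀, hi₀, hDi₀⟩ := hex
      have hDsa : IsSemialgebraic ℚ D := h𝒯.isSemialgebraic D hD𝒯
      have hsub : ∀ i ∈ I, D ∈ 𝒞 i → D ⊆ (ρ i).domain := fun i hi h =>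
        hU i hi ▸ subset_sUnion_of_mem h
      have hcoef : ∀ i ∈ I, ε i • (if D ∈ 𝒞 i then of (soloInformedCadRep (ρ i) D) else 0 :
          FormalRep) = (if D ⊆ (ρ i).domain then ε i else 0) •
            of (soloInformedCadRep (ρ i₀) D) := by
        intro i hi
        by_cases h : D ∈ 𝒞 i
        · rw [if_pos h, if_pos (hsub i hi h),
            soloInformed_cadRep_eq_of_integrand_one hDsa (hsub i hi h) (hsub i₀ hi₀ hDi₀)
              (hone i hi) (hone i₀ hi₀)]
        · have h' : ¬ D ⊆ (ρ i).domain := fun hs =>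
            h (soloInformed_cell_mem_of_subset h𝒯.isPartition (h𝒞 i hi) (hU i hi) hD𝒯 hs)
          rw [if_neg h, if_neg h', smul_zero, zero_smul]
      rw [Finset.sum_congr rfl hcoef, ← Finset.sum_smul, ← Finset.sum_filter,
        hmult D hD𝒯 hDo, zero_smul]
    · push Not at hex
      refine Finset.sum_eq_zero fun i hi => ?_
      rw [if_neg (hex i hi), smul_zero]
  rw [h2, sub_zero] at h1
  exact h1

end Summit.KontsevichZagierPeriods.KontsevichZagierPeriods.Theorems
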